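import Summits.QuantumFields.BalabanUV.Beta.GAN24.RelInvWardPairingStep

/-!
# `BalabanUV.Beta.GAN24.DataColumnCombRows` — binder row G-an2-4 ∕ (CONV-C), the (S) row ∕ (W-γ) toolkit, EVERY LEVEL:
# **THE EULER–LAGRANGE ROWS OF THE DATA COLUMNS HOLD ON THE COMB BONDS TOO (ZERO GAUGE MULTIPLIER), AND THE WARD PAIRINGS NEED NO AXIAL REPRESENTATIVE**
# (G-an2-4 CRUX TEAM (2), seat `b2b-balaban-gan24-formalise-leaf-06` = the (γ) hand, gen 49, FILE (T1))

NOT IN PRINT; OUR BOOKKEEPING ([folklore] kernel bookkeeping BY NAME over an2's relative-inverse chain: the FULL composition identities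
`RelInvBorderedHessian.comp_bhK_coDressKBmAt_KInv : bhK N ∘ G₀ = piKBmC` (gen 13) and `RelInvBorderedHessianStep.comp_bhKStep_coDressKBmAt :
bhKStep d Lc (j+1) ∘ G_{j+1} = piKBmC` (gen 15), the `rfl` entry `AxialCoordinateProjectorCoarseRules.piKBmC_inl_inr = 0`, the action lemmas
`BorderedHessian.comp_bhK_inl` ∕ `comp_bhKStep_succ_inl`, leaf-06 g46 `RelInvWardPairing` §1 and road-P2 g41 `RelInvWardPairingStep` §2 (adjointness ∕ Fubini),
an2's co-closedness `BorderedHessian.codiff₁_wΦ_right`, `AffineAveraging.contourSum_dz ∕ curv_dz`; 0 `def`, 0 cited fact, 0 `def … : Prop`, 0 sorry).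
HONEST FRAMING (cell contract, verbatim): «discharging `BetaPertH` makes Bałaban's UV stability UNCONDITIONAL — a real constructive-QFT result; it is NOT the continuum limit and NOT
the Clay problem.»  HONEST DEPENDENCY (verbatim): «continuum YM on T⁴ ⇐ BetaPertH ∧ nine spine estimates (0/9 proved); BetaPertH ⇐ (D1) ∧ (D4) ∧ CAP+tail; G-an2-4 gates asym,
D1 and NE2/3/4.»

WHY.  Every consumer of an2's relative inverse `RelInv G_j 𝕄_j E` in the (S)-row ∕ (W-γ) files (leaf-06 g46 `RelInvWardPairing.fieldRow_eq_of_relInv` ∕ `ward_pairing`, road-P2 g41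
`RelInvWardPairingStep.fieldRow_eq_of_relInv_step` ∕ `ward_pairing_step` ∕ `tsum_E2image_mul_colH_eq`, leaf-06 g47 FILE C, road-P2 g43 `ExitChargeSourcePairing`) reads RULE 4
`(E ∘ 𝕄_j) ∘ G_j = E` only, i.e. the Euler–Lagrange rows on the NON-comb bonds, and therefore pairs only with 1-forms `m` VANISHING ON THE COMB BONDS — whence the comb-free
representatives `n_m := Π^ρ m − …` of FILE C ∕ D.  But an2's chain proves MORE and the tree already holds it: the composition `𝕄_j ∘ G_j` is the kernel `piKBmC` at ALL rows, and
`piKBmC`'s field–multiplier block is `0` by `rfl`.  So for every DATA column of `G_j` (second index a multiplier slot `(z, inr μ)`: the response to a prescribed block average —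
the `ℋ`-column `colH` and the multiplier column `colM`) the field row `(Δ_j · fcol − s_j·𝒬ᵀ_{Lc} · mcol)_κ(u)` vanishes at EVERY fine bond `(κ, u)`, COMB BONDS INCLUDED: the
Lagrange multiplier of the axial gauge condition is ZERO on responses to data (gauge covariance of the block averaging: any field can be brought to the comb gauge at fixed
block averages, and the field operator is gauge invariant).  ENGINE E-leaf06-g48-1 (E29 parts 6h–6i, kit j176049 ∕ j176112; D = 2, Lc = 3, float64) saw exactly this as (E1)∕(E2):
`Δ_0 v + 𝒬_0ᵀλ = 0` on the comb bonds with residual ≤ 3e-13 for every datum, `λ = −C h` to 2e-13, and the same one level up.  For a FORCE column `(z, inl β)` the comb rows carry the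
field row of `Π_bm` (§2, displayed) — the gauge multiplier of a force, as it must be.
CONSEQUENCE typed here: the Ward ∕ column pairings of the two earlier files for EVERY BOUNDED `m` (no comb hypothesis, §4); the sequel `MultiplierColumnCoarseGauge` derives from §4
the orthogonality of every multiplier column to the bounded coarse pure gauges (the multiplier response to data is coarse-divergence-free).
* §1 `comp_piKBmC_inl_of_noFieldSource`, **`fieldRow_comp_eq_zero_of_noFieldSource`**: `𝕄 ∘ G = piKBmC`, `𝕄 G W` spread, the column `(x, b)` of `W` has no field legs ⇒
  `(𝕄 ∘ (G ∘ W)) u x (inl κ) b = 0` for EVERY `(κ, u)`.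
* §2 LEVEL `0` (`G₀ := coDressKBmAt (toSite r) N (KInv N)`, in-block root, every `N ≥ 1`): **`curvAdj_curv_colH_eq_contourSumAdj_colM`** — `(d*d colH G₀ N μ y)_κ(u) = (𝒬ᵀ_N colM G₀ N μ y)_κ(u)`
  at EVERY bond; `curvAdj_curv_fcol_eq_of_noFieldSource` (columns of `G₀ ∘ W`); `fieldRow_fcol_inl_eq_piKBm` (force columns: the row is `Π_bm`'s entry, comb or not); the `KInvStep Lc 0` alias.
* §3 LEVEL `j + 1` (`G_{j+1} := coDressKBmAt (toSite r) Lc (KInvStep Lc (j+1))`): **`E2row_colH_eq_contourSumAdj_colM_succ`** —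
  `wVH_{j+1}·Σ'_v Σ_l wΦ_{Lc^{j+1}} κ l (u − v)·colH G_{j+1} Lc μ y l v = stepScale_{j+1}·(𝒬ᵀ_{Lc} colM G_{j+1} Lc μ y)_κ(u)` at EVERY bond; `E2row_fcol_eq_of_noFieldSource_succ`.
* §4 THE PAIRINGS FOR EVERY BOUNDED `m`: **`ward_pairing_of_noFieldSource`** (level 0, generic `G` with `bhK N ∘ G = piKBmC`), **`tsum_curvAdj_curv_mul_colH_eq`**
  (`Σ'_u Σ_κ (d*d m) κ u·colH G₀ N ν y′ κ u = Σ'_y Σ_κ (𝒬_N m) κ y·colM G₀ N ν y′ κ y`), **`ward_pairing_step_of_noFieldSource`**, **`tsum_E2image_mul_colH_eq_all`** (road-P2 g41 §5 with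
  the hypothesis «`m` zero on the comb bonds» DELETED).
Asserts NO value of any resolvent column or table; NOTHING of (W-γ) at levels ≥ 1 ∕ (INV) ∕ (S) ∕ «T2Shape» ∕ (hW, hWall) discharged; NEVER «G-an2-4 closed» as (CONV-C); NOT D1,
NOT `BetaPertH`, NOT continuum, NOT Clay.  2026-08-23; no existing file touched.
-/

noncomputable section

open Finset
open scoped BigOperators
open Literature.Probability.LatticeModels (Torus.proj)
open Literature.MathematicalPhysics.QuantumFieldTheory
open Literature.MathematicalPhysics.QuantumFieldTheory.Balaban1983to89
open Literature.MathematicalPhysics.QuantumFieldTheory.Balaban1983to89.Beta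
open B12Sec2to5 (l1 l1_nonneg)
open ExpKernelCalculus (Site MKer Decays comp summable_exp_shift summable_exp_shift')
open AffineAveraging (Form0 Form1 Form2 box toSite unitVec unitVec_apply dz curv curvAdj codiff₁ contourSum)
open AffineReproduction (contourSumAdj)
open LatticeForm (quo)
open KKTFluctuationEnergy (contourSumAdj_eq quo_zsmul_add_toSite)
open KernelSpecInstance (wΦ)
open OneStepResolventKernel (Fib KInv)
open OneStepKernelFamily (KInvStep colH)
open SecondOrderResponse (colM)
open BalabanStepJetsSucc (wVH)
open HessKerSchurResolvent (idK idK_apply comp_idK_right)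
open Summit.QuantumFields.BalabanUV.Beta.TameKernelCalculus
open Summit.QuantumFields.BalabanUV.Beta.ChartConjugationRelative (spr_comp)
open Summit.QuantumFields.BalabanUV.Beta.AxialDressingRooted (IsCombBondAt coDressKBmAt spr_coDressKBmAt one_le_of_neZero piKBm piKBmC piKBmC_inl_inl piKBmC_inl_inr)
open Summit.QuantumFields.BalabanUV.Beta.BorderedHessian (bhK fcol mcol fcol_apply mcol_apply comp_bhK_inl spr_bhK spr_KInv comp_bhK_coDressKBmAt_KInv KInvStep_zero_eq
  stepScale bhKStep spr_bhKStep comp_bhKStep_succ_inl spr_KInvStep comp_bhKStep_coDressKBmAt)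
open Summit.QuantumFields.BalabanUV.Beta.GAN24.RelInvWardPairing (summable_bdd_mul tsum_mul_curvAdj_curv_comm summable_abs_curvAdj tsum_mul_contourSumAdj_bdd
  summable_abs_comp_quo)
open Summit.QuantumFields.BalabanUV.Beta.GAN24.RelInvWardPairingStep (summable_wΦ_mul_col tsum_sum_mul_tsum_sum_wΦ_comm)

namespace Summit.QuantumFields.BalabanUV.Beta.GAN24.DataColumnCombRows

variable {d : ℕ}

/-! ## §1 Field rows of `𝕄 ∘ (G ∘ W)` from a full composition identity `𝕄 ∘ G = piKBmC` -/

/-- [folklore] A column of `piKBmC ∘ W` whose `W`-source has NO FIELD LEGS has zero field rows: `piKBmC`'s field–multiplier block is `0`. -/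
theorem comp_piKBmC_inl_of_noFieldSource (ρ : Fin (d + 1) → ℤ) (N : ℕ) {W : MKer (d + 1) (Fib d)} {x : Fin (d + 1) → ℤ} {b : Fib d}
    (hW0 : ∀ (y : Fin (d + 1) → ℤ) (β : Fin (d + 1)), W y x (Sum.inl β) b = 0) (κ : Fin (d + 1)) (u : Fin (d + 1) → ℤ) :
    comp (piKBmC ρ N) W u x (Sum.inl κ) b = 0 := by
  unfold ExpKernelCalculus.comp
  have e : ∀ y : Fin (d + 1) → ℤ, ∑ f : Fib d, piKBmC ρ N u y (Sum.inl κ) f * W y x f b = 0 := fun y => by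
    rw [Fintype.sum_sum_type]
    simp only [piKBmC_inl_inr, zero_mul, Finset.sum_const_zero, add_zero]
    exact Finset.sum_eq_zero fun β _ => by rw [hW0 y β, mul_zero]
  rw [tsum_congr e, tsum_zero]

/-- NOT IN PRINT; OUR BOOKKEEPING.  **THE FIELD ROWS OF `𝕄 ∘ (G ∘ W)` VANISH AT EVERY BOND FOR COLUMNS WITHOUT FIELD SOURCE**: if `𝕄 ∘ G = piKBmC ρ N` (an2's full composition
identity, rules 3–4 BEFORE the projection by `E`), `𝕄`, `G`, `W` spread and the column `(x, b)` of `W` has no field legs, then `(𝕄 ∘ (G ∘ W)) u x (inl κ) b = 0` for EVERY fine bond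
`(κ, u)` — comb bonds included. -/
theorem fieldRow_comp_eq_zero_of_noFieldSource {ρ : Fin (d + 1) → ℤ} {N : ℕ} {M G W : MKer (d + 1) (Fib d)} (hMG : comp M G = piKBmC ρ N)
    (hMs : Spr M) (hGs : Spr G) (hWs : Spr W) {x : Fin (d + 1) → ℤ} {b : Fib d} (hW0 : ∀ (y : Fin (d + 1) → ℤ) (β : Fin (d + 1)), W y x (Sum.inl β) b = 0)
    (κ : Fin (d + 1)) (u : Fin (d + 1) → ℤ) :
    comp M (comp G W) u x (Sum.inl κ) b = 0 := by
  rw [comp_assoc_tame hMs.tame hGs.tame hWs.tame, hMG]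
  exact comp_piKBmC_inl_of_noFieldSource ρ N hW0 κ u

/-- [folklore] The identity source `idK` has no field legs in a multiplier-slot column. -/
theorem idK_inl_inr_eq_zero (y x : Fin (d + 1) → ℤ) (β μ : Fin (d + 1)) : (idK : MKer (d + 1) (Fib d)) y x (Sum.inl β) (Sum.inr μ) = 0 := by
  classical
  rw [idK_apply, if_neg (fun h => Sum.inl_ne_inr h.2)]

/-! ## §2 Level `0`: the data columns of `G₀ = coDressKBmAt (toSite r) N (KInv N)` satisfy Euler–Lagrange at every bond -/

section LevelZero

variable {N : ℕ} [NeZero N] {r : Fin (d + 1) → ℕ}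

/-- NOT IN PRINT; OUR BOOKKEEPING.  **COLUMNS OF `G₀ ∘ W` WITHOUT FIELD SOURCE: EULER–LAGRANGE AT EVERY BOND** — `(d*d (G₀∘W)^F_{·xb})_κ(u) = (𝒬ᵀ_N (G₀∘W)^M_{·xb})_κ(u)` for EVERY
`(κ, u)` (in-block root, `W` spread, `W y x (inl β) b = 0` for all `y β`). -/
theorem curvAdj_curv_fcol_eq_of_noFieldSource (hr : r ∈ box (d + 1) N) {W : MKer (d + 1) (Fib d)} (hWs : Spr W) {x : Fin (d + 1) → ℤ} {b : Fib d}
    (hW0 : ∀ (y : Fin (d + 1) → ℤ) (β : Fin (d + 1)), W y x (Sum.inl β) b = 0) (κ : Fin (d + 1)) (u : Fin (d + 1) → ℤ) :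
    curvAdj (curv (fcol (comp (coDressKBmAt (toSite r) N (KInv (N := N))) W) x b)) κ u
      = contourSumAdj N (mcol N (comp (coDressKBmAt (toSite r) N (KInv (N := N))) W) x b) κ u := by
  have hN : 1 ≤ N := one_le_of_neZero N
  have h := fieldRow_comp_eq_zero_of_noFieldSource (comp_bhK_coDressKBmAt_KInv hr) (spr_bhK hN) (spr_coDressKBmAt hN hr spr_KInv) hWs hW0 κ u
  rw [comp_bhK_inl] at h
  exact sub_eq_zero.1 h

/-- NOT IN PRINT; OUR BOOKKEEPING.  **THE `ℋ`-COLUMN OF `G₀` SATISFIES EULER–LAGRANGE AT EVERY BOND, COMB BONDS INCLUDED** (zero gauge multiplier for data):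
`(d*d colH G₀ N μ y)_κ(u) = (𝒬ᵀ_N colM G₀ N μ y)_κ(u)` for every coarse bond `(μ, y)` and EVERY fine bond `(κ, u)` (in-block root `toSite r`, every `N ≥ 1`). -/
theorem curvAdj_curv_colH_eq_contourSumAdj_colM (hr : r ∈ box (d + 1) N) (μ : Fin (d + 1)) (y : Fin (d + 1) → ℤ) (κ : Fin (d + 1)) (u : Fin (d + 1) → ℤ) :
    curvAdj (curv (colH (coDressKBmAt (toSite r) N (KInv (N := N))) N μ y)) κ u
      = contourSumAdj N (colM (coDressKBmAt (toSite r) N (KInv (N := N))) N μ y) κ u := by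
  have h := congrArg (fun K => K u ((N : ℤ) • y) (Sum.inl κ) (Sum.inr μ)) (comp_bhK_coDressKBmAt_KInv (N := N) (d := d) hr)
  simp only [comp_bhK_inl, piKBmC_inl_inr] at h
  exact sub_eq_zero.1 h

/-- NOT IN PRINT; OUR BOOKKEEPING.  **FORCE COLUMNS: THE FIELD ROW IS `Π_bm`'S ENTRY, AT EVERY BOND** — for the column `(z, inl β)` of `G₀`,
`(d*d (G₀)^F_{·,(z,inl β)})_κ(u) − (𝒬ᵀ_N (G₀)^M_{·,(z,inl β)})_κ(u) = piKBm (toSite r) N u z (inl κ) (inl β)`; on a NON-comb `(κ, u)` this is `[κ = β ∧ u = z]`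
(`BorderedHessian.pmBm_of_not_isCombBond`), on a comb bond it is the gauge multiplier of the force source. -/
theorem fieldRow_fcol_inl_eq_piKBm (hr : r ∈ box (d + 1) N) (z : Fin (d + 1) → ℤ) (β κ : Fin (d + 1)) (u : Fin (d + 1) → ℤ) :
    curvAdj (curv (fcol (coDressKBmAt (toSite r) N (KInv (N := N))) z (Sum.inl β))) κ u
        - contourSumAdj N (mcol N (coDressKBmAt (toSite r) N (KInv (N := N))) z (Sum.inl β)) κ u
      = piKBm (toSite r) N u z (Sum.inl κ) (Sum.inl β) := by
  have h := congrArg (fun K => K u z (Sum.inl κ) (Sum.inl β)) (comp_bhK_coDressKBmAt_KInv (N := N) (d := d) hr)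
  simp only [comp_bhK_inl, piKBmC_inl_inl] at h
  exact h

end LevelZero

section StepZero

variable {Lc : ℕ} [NeZero Lc] {r : Fin (d + 1) → ℕ}

/-- NOT IN PRINT; OUR BOOKKEEPING.  The `KInvStep Lc 0` alias of `curvAdj_curv_colH_eq_contourSumAdj_colM` (`KInvStep Lc 0 = KInv Lc`, an2's `KInvStep_zero_eq`): the
`ℋ`-column of `G₀ = coDressKBmAt (toSite r) Lc (KInvStep Lc 0)` satisfies Euler–Lagrange at EVERY bond. -/
theorem curvAdj_curv_colH_eq_contourSumAdj_colM_stepZero (hr : r ∈ box (d + 1) Lc) (μ : Fin (d + 1)) (y : Fin (d + 1) → ℤ) (κ : Fin (d + 1))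
    (u : Fin (d + 1) → ℤ) :
    curvAdj (curv (colH (coDressKBmAt (toSite r) Lc (KInvStep (d := d) Lc 0)) Lc μ y)) κ u
      = contourSumAdj Lc (colM (coDressKBmAt (toSite r) Lc (KInvStep (d := d) Lc 0)) Lc μ y) κ u := by
  rw [KInvStep_zero_eq]
  exact curvAdj_curv_colH_eq_contourSumAdj_colM hr μ y κ u

end StepZero

/-! ## §3 Level `j + 1`: the data columns of `G_{j+1} = coDressKBmAt (toSite r) Lc (KInvStep Lc (j+1))` satisfy Euler–Lagrange at every bond -/

section Succ

variable {Lc : ℕ} [NeZero Lc] {r : Fin (d + 1) → ℕ}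

/-- NOT IN PRINT; OUR BOOKKEEPING.  **COLUMNS OF `G_{j+1} ∘ W` WITHOUT FIELD SOURCE: EULER–LAGRANGE AT EVERY BOND** —
`wVH_{j+1}·Σ'_v Σ_l wΦ_{Lc^{j+1}} κ l (u − v)·(G_{j+1}∘W) v x (inl l) b = stepScale_{j+1}·(𝒬ᵀ_{Lc} (G_{j+1}∘W)^M_{·xb})_κ(u)` for EVERY `(κ, u)`. -/
theorem E2row_fcol_eq_of_noFieldSource_succ (hr : r ∈ box (d + 1) Lc) (j : ℕ) {W : MKer (d + 1) (Fib d)} (hWs : Spr W) {x : Fin (d + 1) → ℤ} {b : Fib d}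
    (hW0 : ∀ (y : Fin (d + 1) → ℤ) (β : Fin (d + 1)), W y x (Sum.inl β) b = 0) (κ : Fin (d + 1)) (u : Fin (d + 1) → ℤ) :
    wVH d Lc (j + 1) * (∑' v, ∑ l : Fin (d + 1), wΦ (N := Lc ^ (j + 1)) κ l (u - v) * comp (coDressKBmAt (toSite r) Lc (KInvStep (d := d) Lc (j + 1))) W v x (Sum.inl l) b)
      = stepScale d Lc (j + 1) * contourSumAdj Lc (mcol Lc (comp (coDressKBmAt (toSite r) Lc (KInvStep (d := d) Lc (j + 1))) W) x b) κ u := by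
  have hLc : 1 ≤ Lc := one_le_of_neZero Lc
  have hGs : Spr (coDressKBmAt (toSite r) Lc (KInvStep (d := d) Lc (j + 1))) := spr_coDressKBmAt hLc hr (spr_KInvStep (j + 1))
  obtain ⟨C, δ, hδ, hVd⟩ := spr_comp hGs hWs
  have h := fieldRow_comp_eq_zero_of_noFieldSource (comp_bhKStep_coDressKBmAt hr j) (spr_bhKStep (j + 1)) hGs hWs hW0 κ u
  rw [comp_bhKStep_succ_inl j _ u x κ b (summable_wΦ_mul_col (Lc ^ (j + 1)) hVd hδ κ u x b)] at h
  exact sub_eq_zero.1 h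

/-- NOT IN PRINT; OUR BOOKKEEPING.  **THE `ℋ`-COLUMN OF `G_{j+1}` SATISFIES EULER–LAGRANGE AT EVERY BOND, COMB BONDS INCLUDED** (zero gauge multiplier for data, every `j`):
`wVH_{j+1}·Σ'_v Σ_l wΦ_{Lc^{j+1}} κ l (u − v)·colH G_{j+1} Lc μ y l v = stepScale_{j+1}·(𝒬ᵀ_{Lc} colM G_{j+1} Lc μ y)_κ(u)` for every coarse bond `(μ, y)` and EVERY fine bond `(κ, u)`. -/
theorem E2row_colH_eq_contourSumAdj_colM_succ (hr : r ∈ box (d + 1) Lc) (j : ℕ) (μ : Fin (d + 1)) (y : Fin (d + 1) → ℤ) (κ : Fin (d + 1)) (u : Fin (d + 1) → ℤ) :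
    wVH d Lc (j + 1) * (∑' v, ∑ l : Fin (d + 1), wΦ (N := Lc ^ (j + 1)) κ l (u - v) * colH (coDressKBmAt (toSite r) Lc (KInvStep (d := d) Lc (j + 1))) Lc μ y l v)
      = stepScale d Lc (j + 1) * contourSumAdj Lc (colM (coDressKBmAt (toSite r) Lc (KInvStep (d := d) Lc (j + 1))) Lc μ y) κ u := by
  have hLc : 1 ≤ Lc := one_le_of_neZero Lc
  obtain ⟨C, δ, hδ, hGd⟩ := spr_coDressKBmAt hLc hr (spr_KInvStep (d := d) (Lc := Lc) (j + 1))
  have h := congrArg (fun K => K u ((Lc : ℤ) • y) (Sum.inl κ) (Sum.inr μ)) (comp_bhKStep_coDressKBmAt (d := d) hr j)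
  simp only [piKBmC_inl_inr] at h
  rw [comp_bhKStep_succ_inl j _ u ((Lc : ℤ) • y) κ (Sum.inr μ) (summable_wΦ_mul_col (Lc ^ (j + 1)) hGd hδ κ u ((Lc : ℤ) • y) (Sum.inr μ))] at h
  exact sub_eq_zero.1 h

end Succ

/-! ## §4 The Ward pairings for EVERY bounded 1-form (no axial representative needed) -/

section PairingZero

variable {N : ℕ} [NeZero N]

/-- NOT IN PRINT; OUR BOOKKEEPING.  **THE LEVEL-0 WARD PAIRING FOR EVERY BOUNDED `m`** (leaf-06 g46 `RelInvWardPairing.ward_pairing` with the comb hypothesis on `m` REPLACED by «no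
field source»): `bhK N ∘ G = piKBmC ρ N`, `G W` spread, the column `(x, b)` of `W` without field legs, `m` BOUNDED (any values on the comb bonds) ⇒
`Σ'_u Σ_κ (d*d m) κ u·(G∘W) u x (inl κ) b = Σ'_y Σ_κ (𝒬_N m) κ y·(G∘W) (N•y) x (inr κ) b`. -/
theorem ward_pairing_of_noFieldSource {ρ : Fin (d + 1) → ℤ} {G W : MKer (d + 1) (Fib d)} (hMG : comp (bhK N) G = piKBmC ρ N) (hGs : Spr G) (hWs : Spr W)
    {m : Form1 (d + 1) ℝ} {B : ℝ} (hmB : ∀ κ u, |m κ u| ≤ B) {x : Fin (d + 1) → ℤ} {b : Fib d}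
    (hW0 : ∀ (y : Fin (d + 1) → ℤ) (β : Fin (d + 1)), W y x (Sum.inl β) b = 0) :
    ∑' u, ∑ κ, curvAdj (curv m) κ u * comp G W u x (Sum.inl κ) b = ∑' y, ∑ κ, contourSum N m κ y * comp G W ((N : ℤ) • y) x (Sum.inr κ) b := by
  classical
  have hN : 1 ≤ N := one_le_of_neZero N
  obtain ⟨C, δ, hδ, hVd⟩ := spr_comp hGs hWs
  have hF : ∀ κ, Summable fun u => |fcol (comp G W) x b κ u| := fun κ =>
    Summable.of_nonneg_of_le (fun u => abs_nonneg _) (fun u => hVd u x (Sum.inl κ) b) ((summable_exp_shift' hδ x).mul_left C)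
  have hφ : ∀ κ, Summable fun u : Fin (d + 1) → ℤ => |mcol N (comp G W) x b κ (quo N u)| := fun κ =>
    summable_abs_comp_quo hN hδ hVd x (Sum.inr κ) b
  -- the pointwise identity at EVERY bond, summed against `m`
  have hpt : ∀ u, (∑ κ, m κ u * curvAdj (curv (fcol (comp G W) x b)) κ u) = ∑ κ, m κ u * contourSumAdj N (mcol N (comp G W) x b) κ u := by
    intro u
    refine Finset.sum_congr rfl fun κ _ => ?_
    have h := fieldRow_comp_eq_zero_of_noFieldSource hMG (spr_bhK hN) hGs hWs hW0 κ u
    rw [comp_bhK_inl] at h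
    rw [sub_eq_zero.1 h]
  have hsum : (∑' u, ∑ κ, m κ u * curvAdj (curv (fcol (comp G W) x b)) κ u) = ∑' u, ∑ κ, m κ u * contourSumAdj N (mcol N (comp G W) x b) κ u :=
    tsum_congr hpt
  rw [tsum_mul_curvAdj_curv_comm hmB hF, tsum_mul_contourSumAdj_bdd hmB hφ] at hsum
  have e2 : (fun y => ∑ κ, mcol N (comp G W) x b κ y * contourSum N m κ y) = fun y => ∑ κ, contourSum N m κ y * comp G W ((N : ℤ) • y) x (Sum.inr κ) b := by
    funext y; exact Finset.sum_congr rfl fun κ _ => by rw [mcol_apply, mul_comm]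
  rw [e2] at hsum
  exact hsum

variable {r : Fin (d + 1) → ℕ}

/-- NOT IN PRINT; OUR BOOKKEEPING.  **THE LEVEL-0 COLUMN PAIRING FOR EVERY BOUNDED `m`**: for `G₀ = coDressKBmAt (toSite r) N (KInv N)` (in-block root) and every coarse bond `(ν, y′)`,
`Σ'_u Σ_κ (d*d m) κ u·colH G₀ N ν y′ κ u = Σ'_y Σ_κ (𝒬_N m) κ y·colM G₀ N ν y′ κ y` — the `(d*d)`-image of ANY bounded `m` read against the `ℋ`-column is the block contour sum of
`m` read against the multiplier column (no hard-axial representative of `m` is needed). -/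
theorem tsum_curvAdj_curv_mul_colH_eq (hr : r ∈ box (d + 1) N) {m : Form1 (d + 1) ℝ} {B : ℝ} (hmB : ∀ κ u, |m κ u| ≤ B) (ν : Fin (d + 1)) (y' : Fin (d + 1) → ℤ) :
    ∑' u, ∑ κ, curvAdj (curv m) κ u * colH (coDressKBmAt (toSite r) N (KInv (N := N))) N ν y' κ u
      = ∑' y, ∑ κ, contourSum N m κ y * colM (coDressKBmAt (toSite r) N (KInv (N := N))) N ν y' κ y := by
  classical
  have hN : 1 ≤ N := one_le_of_neZero N
  have hW := ward_pairing_of_noFieldSource (comp_bhK_coDressKBmAt_KInv hr) (spr_coDressKBmAt hN hr spr_KInv) spr_idK hmB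
    (x := (N : ℤ) • y') (b := Sum.inr ν) (fun y β => idK_inl_inr_eq_zero y _ β ν)
  rw [comp_idK_right] at hW
  exact hW

end PairingZero

section PairingStepZero

variable {Lc : ℕ} [NeZero Lc] {r : Fin (d + 1) → ℕ}

/-- NOT IN PRINT; OUR BOOKKEEPING.  The `KInvStep Lc 0` alias of `tsum_curvAdj_curv_mul_colH_eq`. -/
theorem tsum_curvAdj_curv_mul_colH_eq_stepZero (hr : r ∈ box (d + 1) Lc) {m : Form1 (d + 1) ℝ} {B : ℝ} (hmB : ∀ κ u, |m κ u| ≤ B) (ν : Fin (d + 1))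
    (y' : Fin (d + 1) → ℤ) :
    ∑' u, ∑ κ, curvAdj (curv m) κ u * colH (coDressKBmAt (toSite r) Lc (KInvStep (d := d) Lc 0)) Lc ν y' κ u
      = ∑' y, ∑ κ, contourSum Lc m κ y * colM (coDressKBmAt (toSite r) Lc (KInvStep (d := d) Lc 0)) Lc ν y' κ y := by
  rw [KInvStep_zero_eq]
  exact tsum_curvAdj_curv_mul_colH_eq hr hmB ν y'

end PairingStepZero

section PairingSucc

variable {Lc : ℕ} [NeZero Lc]

/-- NOT IN PRINT; OUR BOOKKEEPING.  **THE STEP-(j+1) WARD PAIRING FOR EVERY BOUNDED `m`** (road-P2 g41 `RelInvWardPairingStep.ward_pairing_step` with the comb hypothesis on `m` REPLACED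
by «no field source»): `bhKStep d Lc (j+1) ∘ G = piKBmC ρ Lc`, `G W` spread, the column `(x, b)` of `W` without field legs, `m` BOUNDED ⇒
`Σ'_u Σ_κ (wVH_{j+1}·Σ'_v Σ_l wΦ_{Lc^{j+1}} κ l (u − v)·m l v)·(G∘W) u x (inl κ) b = stepScale_{j+1}·Σ'_y Σ_κ (𝒬_{Lc} m) κ y·(G∘W) (Lc•y) x (inr κ) b`. -/
theorem ward_pairing_step_of_noFieldSource {ρ : Fin (d + 1) → ℤ} (j : ℕ) {G W : MKer (d + 1) (Fib d)} (hMG : comp (bhKStep d Lc (j + 1)) G = piKBmC ρ Lc)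
    (hGs : Spr G) (hWs : Spr W) {m : Form1 (d + 1) ℝ} {B : ℝ} (hmB : ∀ κ u, |m κ u| ≤ B) {x : Fin (d + 1) → ℤ} {b : Fib d}
    (hW0 : ∀ (y : Fin (d + 1) → ℤ) (β : Fin (d + 1)), W y x (Sum.inl β) b = 0) :
    ∑' u, ∑ κ, (wVH d Lc (j + 1) * ∑' v, ∑ l : Fin (d + 1), wΦ (N := Lc ^ (j + 1)) κ l (u - v) * m l v) * comp G W u x (Sum.inl κ) b
      = stepScale d Lc (j + 1) * ∑' y, ∑ κ, contourSum Lc m κ y * comp G W ((Lc : ℤ) • y) x (Sum.inr κ) b := by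
  classical
  have hLc : 1 ≤ Lc := one_le_of_neZero Lc
  obtain ⟨C, δ, hδ, hVd⟩ := spr_comp hGs hWs
  have hφ : ∀ κ, Summable fun u : Fin (d + 1) → ℤ => |mcol Lc (comp G W) x b κ (quo Lc u)| := fun κ =>
    summable_abs_comp_quo hLc hδ hVd x (Sum.inr κ) b
  -- the pointwise identity at EVERY bond, summed against `m`
  have hpt : ∀ u, (∑ κ, m κ u * (wVH d Lc (j + 1) * ∑' v, ∑ l : Fin (d + 1), wΦ (N := Lc ^ (j + 1)) κ l (u - v) * comp G W v x (Sum.inl l) b))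
      = ∑ κ, m κ u * (stepScale d Lc (j + 1) * contourSumAdj Lc (mcol Lc (comp G W) x b) κ u) := by
    intro u
    refine Finset.sum_congr rfl fun κ _ => ?_
    have h := fieldRow_comp_eq_zero_of_noFieldSource hMG (spr_bhKStep (j + 1)) hGs hWs hW0 κ u
    rw [comp_bhKStep_succ_inl j (comp G W) u x κ b (summable_wΦ_mul_col (Lc ^ (j + 1)) hVd hδ κ u x b)] at h
    rw [sub_eq_zero.1 h]
  have hsum : (∑' u, ∑ κ, m κ u * (wVH d Lc (j + 1) * ∑' v, ∑ l : Fin (d + 1), wΦ (N := Lc ^ (j + 1)) κ l (u - v) * comp G W v x (Sum.inl l) b))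
      = ∑' u, ∑ κ, m κ u * (stepScale d Lc (j + 1) * contourSumAdj Lc (mcol Lc (comp G W) x b) κ u) := tsum_congr hpt
  -- move the value Hessian onto `m` (road-P2 §2) and `𝒬ᵀ` onto `m` (leaf-06 §1)
  have eA : (∑' u, ∑ κ, m κ u * (wVH d Lc (j + 1) * ∑' v, ∑ l : Fin (d + 1), wΦ (N := Lc ^ (j + 1)) κ l (u - v) * comp G W v x (Sum.inl l) b))
      = wVH d Lc (j + 1) * ∑' v, ∑ l : Fin (d + 1), (∑' u, ∑ κ, wΦ (N := Lc ^ (j + 1)) l κ (v - u) * m κ u) * comp G W v x (Sum.inl l) b := by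
    rw [← tsum_sum_mul_tsum_sum_wΦ_comm (Lc ^ (j + 1)) hVd hδ hmB x b, ← tsum_mul_left]
    refine tsum_congr fun u => ?_
    rw [Finset.mul_sum]
    exact Finset.sum_congr rfl fun κ _ => by ring
  have eB : (∑' u, ∑ κ, m κ u * (stepScale d Lc (j + 1) * contourSumAdj Lc (mcol Lc (comp G W) x b) κ u))
      = stepScale d Lc (j + 1) * ∑' y, ∑ κ, contourSum Lc m κ y * comp G W ((Lc : ℤ) • y) x (Sum.inr κ) b := by
    have h := tsum_mul_contourSumAdj_bdd (N := Lc) hmB hφ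
    have e2 : (fun y => ∑ κ, mcol Lc (comp G W) x b κ y * contourSum Lc m κ y)
        = fun y => ∑ κ, contourSum Lc m κ y * comp G W ((Lc : ℤ) • y) x (Sum.inr κ) b := by
      funext y; exact Finset.sum_congr rfl fun κ _ => by rw [mcol_apply, mul_comm]
    rw [e2] at h
    rw [← h, ← tsum_mul_left]
    refine tsum_congr fun u => ?_
    rw [Finset.mul_sum]
    exact Finset.sum_congr rfl fun κ _ => by ring
  rw [eA, eB] at hsum
  have eL : (∑' u, ∑ κ, (wVH d Lc (j + 1) * ∑' v, ∑ l : Fin (d + 1), wΦ (N := Lc ^ (j + 1)) κ l (u - v) * m l v) * comp G W u x (Sum.inl κ) b)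
      = wVH d Lc (j + 1) * ∑' v, ∑ l : Fin (d + 1), (∑' u, ∑ κ, wΦ (N := Lc ^ (j + 1)) l κ (v - u) * m κ u) * comp G W v x (Sum.inl l) b := by
    rw [← tsum_mul_left]
    refine tsum_congr fun u => ?_
    rw [Finset.mul_sum]
    exact Finset.sum_congr rfl fun κ _ => by ring
  rw [eL]
  exact hsum

variable {r : Fin (d + 1) → ℕ}

/-- NOT IN PRINT; OUR BOOKKEEPING.  **THE LEVEL-(j+1) COLUMN PAIRING FOR EVERY BOUNDED `m`** (road-P2 g41 `tsum_E2image_mul_colH_eq` with the hypothesis «`m` zero on the comb bonds»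
DELETED; in-block root, every `j`, every coarse bond `(ν, y′)`):
`Σ'_u Σ_κ (wVH_{j+1}·Σ'_v Σ_l wΦ_{Lc^{j+1}} κ l (u − v)·m l v)·G_{j+1} u (Lc•y′) (inl κ)(inr ν) = stepScale_{j+1}·Σ'_y Σ_κ (𝒬_{Lc} m) κ y·G_{j+1} (Lc•y) (Lc•y′) (inr κ)(inr ν)`. -/
theorem tsum_E2image_mul_colH_eq_all (hr : r ∈ box (d + 1) Lc) (j : ℕ) {m : Form1 (d + 1) ℝ} {B : ℝ} (hmB : ∀ κ u, |m κ u| ≤ B) (ν : Fin (d + 1))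
    (y' : Fin (d + 1) → ℤ) :
    ∑' u, ∑ κ, (wVH d Lc (j + 1) * ∑' v, ∑ l : Fin (d + 1), wΦ (N := Lc ^ (j + 1)) κ l (u - v) * m l v)
        * coDressKBmAt (toSite r) Lc (KInvStep (d := d) Lc (j + 1)) u ((Lc : ℤ) • y') (Sum.inl κ) (Sum.inr ν)
      = stepScale d Lc (j + 1) * ∑' y, ∑ κ, contourSum Lc m κ y
          * coDressKBmAt (toSite r) Lc (KInvStep (d := d) Lc (j + 1)) ((Lc : ℤ) • y) ((Lc : ℤ) • y') (Sum.inr κ) (Sum.inr ν) := by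
  classical
  have hLc : 1 ≤ Lc := one_le_of_neZero Lc
  have hW := ward_pairing_step_of_noFieldSource j (comp_bhKStep_coDressKBmAt hr j) (spr_coDressKBmAt hLc hr (spr_KInvStep (j + 1))) spr_idK hmB
    (x := (Lc : ℤ) • y') (b := Sum.inr ν) (fun y β => idK_inl_inr_eq_zero y _ β ν)
  rw [comp_idK_right] at hW
  exact hW

end PairingSucc

end Summit.QuantumFields.BalabanUV.Beta.GAN24.DataColumnCombRows

end
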